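import Literature.AlgebraicGeometry.Resolution.HenselizedRationalArtinSchreier
import Literature.AlgebraicGeometry.Resolution.HenselizedRationalDensity
import HarnessLib

/-!
# Finite Laurent series in a value-transcendental `x` and elements of `K(x)^h`: bookkeeping (Kuhlmann 2010, §4 (4.2), §4.1)

Topic: `Literature/AlgebraicGeometry/Resolution` (valued function fields). Small complements to
`HenselizedRationalDensity.lean` and `HenselizedRationalArtinSchreier.lean` for the Kummer
normal form of F.-V. Kuhlmann, *Elimination of ramification I: The generalized stability
theorem*, Trans. AMS 362 (2010) 5697–5727 = arXiv:1003.5678, §4.1, **Prop. 4.6**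
(`Kuhlmann2010Prop46ValueIndex`, `NormalDegreePDefectlessVTGalois.lean`), which computes with
finite Laurent series `∑ cᵢxⁱ` (`c : ℤ →₀ K`, the ring `R = K[x,x⁻¹]` of (12)) inside
`F = K(x)^h` for `x` value-transcendental over `K`:

> (4.2) … In this case, `F̄ = K̄` and `vF = vK ⊕ ℤvx`. … Since `vF = vK ⊕ ℤvx` and `F̄ = K̄`, we
> can write `a = c x^k u` where `k ∈ ℤ`, `c ∈ K` and `u ∈ F` a `1`-unit. … As `j ∉ pℤ`, this
> value is not in `pvF`.

## Content (everything PROVED)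

* `coe_finsupp_ne_zero`, `valuation_monomial_le_finsuppSum`, `valuation_finsuppSum_le`,
  `valuation_finsuppSum_lt`, `finsuppSum_mem`, `finsuppSum_eq_add_sum_erase`,
  `finsuppSum_add`, `finsuppSum_single` — monomials versus the value of a finite Laurent
  series (valuation independence of the `xⁱ`, (13)), membership, splitting off a monomial.
* `exists_valuation_eq_mul_zpow_of_mem_henselizedAdjoin` — `vF = vK ⊕ ℤvx` with a NON-ZERO
  coefficient: `v(f) = v(c x^k)`, `c ∈ K^×`.
* `exists_eq_mul_zpow_mul_oneUnit_of_mem_henselizedAdjoin` — "`a = c x^k u` with `u` a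
  `1`-unit" (proof of Prop. 4.6).
* `not_valuation_pow_eq_of_not_dvd` — "As `j ∉ pℤ`, this value is not in `p·vF`": no `t ∈ F`
  has `v(t)^p = v(c x^j)` when `p ∤ j`.

## Sources

* F.-V. Kuhlmann, *Elimination of ramification I: The generalized stability theorem*, Trans.
  Amer. Math. Soc. 362 (2010) 5697–5727 = arXiv:1003.5678: Lemma 2.2, Lemma 2.5, §4 (4.2),
  §4.1 ((12), (13), proofs of Props. 4.5–4.6). [Kuhlmann2010]
-/

noncomputable section

open IsLocalRing

namespace Literature.AlgebraicGeometry.Resolution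

universe u

variable {Ω : Type u} [Field Ω] (V : ValuationSubring Ω)

/-! ### Monomials and finite Laurent series in a value-transcendental element -/

section Monomials

variable {K : Subfield Ω} {x : Ω}

omit V in
/-- A non-zero coefficient of `c : ℤ →₀ K` is non-zero in `Ω`. [folklore] -/
theorem coe_finsupp_ne_zero {c : ℤ →₀ K} {i : ℤ} (hi : i ∈ c.support) : ((c i : K) : Ω) ≠ 0 :=
  fun h0 => (Finsupp.mem_support_iff.mp hi) (Subtype.ext h0)

/-- Every monomial of a finite Laurent series is dominated by the value of the sum (the
valuation independence of the `xⁱ`, Kuhlmann 2010, (13)). [cite: Kuhlmann2010, Section 4.1, (13)] -/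
theorem valuation_monomial_le_finsuppSum (hx : IsValueTranscendentalOver V K x) {c : ℤ →₀ K}
    {i : ℤ} (hi : i ∈ c.support) :
    V.valuation ((c i : Ω) * x ^ i) ≤ V.valuation (c.sum fun i a => (a : Ω) * x ^ i) := by
  have hc : c ≠ 0 := by
    rintro rfl
    simp at hi
  obtain ⟨j, hj, hsum, hlt⟩ := exists_valuation_finsupp_sum_eq hx hc
  rw [hsum]
  by_cases hij : i = j
  · rw [hij]
  · exact (hlt i hi hij).le

omit V in
/-- A finite Laurent series with coefficients in `K ≤ F` and `x ∈ F` lies in `F`. [folklore] -/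
theorem finsuppSum_mem {F : Subfield Ω} (hKF : K ≤ F) (hxF : x ∈ F) (c : ℤ →₀ K) :
    (c.sum fun i a => (a : Ω) * x ^ i) ∈ F :=
  sum_mem fun i _ => mul_mem (hKF (c i).2) (zpow_mem hxF i)

/-- Bounding a finite Laurent series by a bound on its monomials. [folklore] -/
theorem valuation_finsuppSum_le {c : ℤ →₀ K} {g : V.ValueGroup}
    (h : ∀ i ∈ c.support, V.valuation ((c i : Ω) * x ^ i) ≤ g) :
    V.valuation (c.sum fun i a => (a : Ω) * x ^ i) ≤ g :=
  Valuation.map_sum_le _ h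

/-- Strictly bounding a finite Laurent series by a strict bound on its monomials. [folklore] -/
theorem valuation_finsuppSum_lt {c : ℤ →₀ K} {g : V.ValueGroup} (hg : g ≠ 0)
    (h : ∀ i ∈ c.support, V.valuation ((c i : Ω) * x ^ i) < g) :
    V.valuation (c.sum fun i a => (a : Ω) * x ^ i) < g :=
  Valuation.map_sum_lt _ hg h

omit V in
/-- Splitting off one monomial: `∑ cᵢxⁱ = c_k x^k + ∑_{i ≠ k} cᵢxⁱ`. [folklore] -/
theorem finsuppSum_eq_add_sum_erase {c : ℤ →₀ K} {k : ℤ} (hk : k ∈ c.support) :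
    (c.sum fun i a => (a : Ω) * x ^ i) =
      (c k : Ω) * x ^ k + (c.erase k).sum fun i a => (a : Ω) * x ^ i := by
  classical
  rw [Finsupp.sum, Finsupp.sum, Finsupp.support_erase, ← Finset.add_sum_erase _ _ hk]
  congr 1
  refine Finset.sum_congr rfl fun i hi => ?_
  rw [Finsupp.erase_ne (Finset.ne_of_mem_erase hi)]

omit V in
/-- Additivity of the value of finite Laurent series in the coefficients. [folklore] -/
theorem finsuppSum_add (c d : ℤ →₀ K) :
    ((c + d).sum fun i a => (a : Ω) * x ^ i) =
      (c.sum fun i a => (a : Ω) * x ^ i) + d.sum fun i a => (a : Ω) * x ^ i := by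
  refine Finsupp.sum_add_index' (fun i => ?_) (fun i b₁ b₂ => ?_)
  · rw [ZeroMemClass.coe_zero]
    exact zero_mul _
  · rw [Subfield.coe_add]
    exact add_mul _ _ _

omit V in
/-- The value of a single monomial. [folklore] -/
theorem finsuppSum_single (k : ℤ) (a : K) :
    ((Finsupp.single k a).sum fun i a => (a : Ω) * x ^ i) = (a : Ω) * x ^ k := by
  rw [Finsupp.sum_single_index]
  rw [ZeroMemClass.coe_zero]
  exact zero_mul _

end Monomials

/-! ### `vF = vK ⊕ ℤvx` and `a = c x^k u` for `F = K(x)^h` -/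

section HenselizedRational

variable [IsAlgClosed Ω] {K : Subfield Ω} {x : Ω}

/-- **`vK(x)^h = vK ⊕ ℤvx` with a non-zero coefficient** (Kuhlmann 2010, (4.2)): every non-zero
`f ∈ K(x)^h` has `v(f) = v(c x^k)` with `c ∈ K^×`, `k ∈ ℤ`
(`exists_valuation_eq_of_mem_henselizedAdjoin`). [cite: Kuhlmann2010, Section 4, (4.2)] -/
theorem exists_valuation_eq_mul_zpow_of_mem_henselizedAdjoin (hx : IsValueTranscendentalOver V K x)
    {f : Ω} (hf : f ∈ henselizedAdjoin V K x) (hf0 : f ≠ 0) :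
    ∃ c ∈ K, c ≠ 0 ∧ ∃ k : ℤ, V.valuation f = V.valuation (c * x ^ k) := by
  obtain ⟨c, hc, k, hfc⟩ := exists_valuation_eq_of_mem_henselizedAdjoin hx hf hf0
  have hc0 : c ≠ 0 := by
    rintro rfl
    rw [map_zero, zero_mul, map_eq_zero] at hfc
    exact hf0 hfc
  exact ⟨c, hc, hc0, k, by rw [hfc, map_mul, map_zpow₀]⟩

/-- **Every non-zero `a ∈ K(x)^h` is `c·x^k·u` with `u` a `1`-unit** ("Since `vF = vK ⊕ ℤvx`
and `F̄ = K̄`, we can write `a = c x^k u` where `k ∈ ℤ`, `c ∈ K` and `u ∈ F` a `1`-unit", proof of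
Prop. 4.6): `c ∈ K^×`, `k ∈ ℤ`, `u ∈ K(x)^h` with `v(u - 1) < 1`. PROVED.
[cite: Kuhlmann2010, Section 4.1, proof of Prop. 4.6] -/
theorem exists_eq_mul_zpow_mul_oneUnit_of_mem_henselizedAdjoin
    (hx : IsValueTranscendentalOver V K x) {a : Ω} (ha : a ∈ henselizedAdjoin V K x)
    (ha0 : a ≠ 0) :
    ∃ c ∈ K, c ≠ 0 ∧ ∃ k : ℤ, ∃ u ∈ henselizedAdjoin V K x,
      V.valuation (u - 1) < 1 ∧ a = c * x ^ k * u := by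
  set F := henselizedAdjoin V K x with hFdef
  have hKF : K ≤ F := le_henselizedAdjoin V K x
  have hxF : x ∈ F := mem_henselizedAdjoin_self V K x
  obtain ⟨c₁, hc₁, hc₁0, k, hval⟩ := exists_valuation_eq_mul_zpow_of_mem_henselizedAdjoin V hx ha ha0
  have hm0 : c₁ * x ^ k ≠ 0 := mul_ne_zero hc₁0 (zpow_ne_zero _ hx.ne_zero)
  -- the unit `a / (c₁ x^k)` is congruent to some `c₂ ∈ K`
  have hu1 : V.valuation (a / (c₁ * x ^ k)) = 1 := by
    rw [map_div₀, hval, div_self ((map_ne_zero _).mpr hm0)]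
  obtain ⟨c₂, hc₂, hc₂1, hlt⟩ := exists_mem_valuation_sub_lt_one_of_mem_henselizedAdjoin hx
    (div_mem ha (mul_mem (hKF hc₁) (zpow_mem hxF k))) hu1
  have hc₂0 : c₂ ≠ 0 := fun h => by rw [h, map_zero] at hc₂1; exact zero_ne_one hc₂1
  refine ⟨c₁ * c₂, mul_mem hc₁ hc₂, mul_ne_zero hc₁0 hc₂0, k, a / (c₁ * x ^ k) / c₂,
    div_mem (div_mem ha (mul_mem (hKF hc₁) (zpow_mem hxF k))) (hKF hc₂), ?_, ?_⟩
  · have : a / (c₁ * x ^ k) / c₂ - 1 = (a / (c₁ * x ^ k) - c₂) / c₂ := by field_simp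
    rw [this, map_div₀, hc₂1, div_one]
    exact hlt
  · have hxk : x ^ k ≠ 0 := zpow_ne_zero _ hx.ne_zero
    field_simp

/-- **"As `j ∉ pℤ`, this value is not in `p·vF`"** (proofs of Props. 4.5–4.6): for `x`
value-transcendental over `K`, `c ∈ K^×`, `p ≠ 0` and `p ∤ j`, no `t ∈ K(x)^h` has
`v(t)^p = v(c x^j)` — `v(t) = v(c' x^m)` would give `v(x)^{j - pm} ∈ vK`. PROVED.
[cite: Kuhlmann2010, Section 4.1, proof of Prop. 4.5] -/
theorem not_valuation_pow_eq_of_not_dvd (hx : IsValueTranscendentalOver V K x) {p : ℕ}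
    (hp : p ≠ 0) {j : ℤ} (hpj : ¬ (p : ℤ) ∣ j) {c : Ω} (hc : c ∈ K) (hc0 : c ≠ 0) {t : Ω}
    (ht : t ∈ henselizedAdjoin V K x) (h : V.valuation t ^ p = V.valuation (c * x ^ j)) :
    False := by
  have hx0 : V.valuation x ≠ 0 := (map_ne_zero _).mpr hx.ne_zero
  have ht0 : t ≠ 0 := by
    rintro rfl
    rw [map_zero, map_mul, map_zpow₀, zero_pow hp] at h
    exact mul_ne_zero ((map_ne_zero _).mpr hc0) (zpow_ne_zero _ hx0) h.symm
  obtain ⟨c', hc', hc'0, m, htv⟩ := exists_valuation_eq_mul_zpow_of_mem_henselizedAdjoin V hx ht ht0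
  -- `v(x)^{j - p m} = v(c'^p / c)`
  have key : V.valuation x ^ (j - p * m) = V.valuation (c' ^ p / c) := by
    rw [map_mul, map_zpow₀] at h
    rw [map_mul, map_zpow₀] at htv
    rw [zpow_sub₀ hx0, map_div₀, map_pow, div_eq_div_iff (zpow_ne_zero _ hx0)
      ((map_ne_zero _).mpr hc0), mul_comm (p : ℤ) m, zpow_mul, zpow_natCast]
    calc V.valuation x ^ j * V.valuation c = V.valuation c * V.valuation x ^ j := mul_comm _ _
      _ = V.valuation t ^ p := h.symm
      _ = (V.valuation c' * V.valuation x ^ m) ^ p := by rw [htv]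
      _ = V.valuation c' ^ p * (V.valuation x ^ m) ^ p := mul_pow _ _ _
  have hne : j - p * m ≠ 0 := by
    intro h0
    apply hpj
    exact ⟨m, by omega⟩
  exact hx.zpow_ne hne (div_mem (pow_mem hc' p) hc) key

end HenselizedRational

end Literature.AlgebraicGeometry.Resolution
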